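import Literature.Barriers.CriticalPhenomena.LongRangeTrivialityOnZ3Moments
import Literature.Probability.LatticeModels.GHSInequality

/-!
# Gaussian domination of the moment generating function of `∑ λ_x σ_x` (`λ ≥ 0`) from the GHS
# inequality, for ferromagnetic pair interactions — a substitute for Newman's inequality in the
# proof of Panis's Theorem 1.2

Sibling of `Literature/Barriers/CriticalPhenomena/LongRangeTrivialityOnZ3.lean` (barrier catalogue
D-0021, sub-problem `Ising3DConformalLimit`). `LongRangeTrivialityOnZ3Moments.lean` reduced the
moment-generating-function display of the proof of Panis 2023, Theorem 5.5 (arXiv:2309.05797, p. 21,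
`panis_mgfDeviation_le_ursellFourBoxSum`, one of the two inputs of `panis_thm12`) to two named facts:
Aizenman's deviation from Wick's law (`panis_evenMoment_deviation_le`, random currents) and NEWMAN's
term-by-term Gaussian domination of the even moments of `X = ∑ λ_xσ_x`, `λ ≥ 0`
(`newman_gaussian_evenMoment_le`; Newman 1975 proves it from the Lee–Yang theorem through Hadamard's
factorisation). In the summation "multiplying by `z^{2n}/(2n)!` and summing over `n`" the domination is
only used through the sum `∑_n z^{2n}⟨X^{2n}⟩/(2n)! = ⟨cosh zX⟩`, i.e. through the moment generating
function. This file PROVES the moment-generating-function form of the domination,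

  `⟨exp(tX)⟩_{Λ,J,0,β} ≤ exp((t²/2)⟨X²⟩_{Λ,J,0,β})`, `X = ∑_{x∈Λ} λ_xσ_x`, `λ ≥ 0`, `J ≥ 0`, `β ≥ 0`, `t ∈ ℝ`

(`LongRangeIsing.expectIn_exp_mul_le_of_ghs`, finite volume, free boundary condition, zero field), and
its infinite-volume form for the smeared observables `T_{f,L,β}` with `f ≥ 0`
(`LongRangeIsing.state_exp_smeared_le_of_ghs`), from the **GHS inequality** `u₃ ≤ 0`
(Griffiths–Hurst–Sherman 1970, Lebowitz 1974), which the tree proves for every spin-½ system with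
nonnegative couplings on supports of at most two sites
(`Literature.Probability.LatticeModels.ghs_gksSum`, `GHSInequality.lean`) — here the pair couplings
`(β/2)J_{z,w}` together with the one-body fields `tλ_z ≥ 0` (`t ≥ 0`). The sibling
`LongRangeTrivialityOnZ3MomentsGHS.lean` redoes the summation with this input, so that
`panis_mgfDeviation_le_ursellFourBoxSum`, `panis_thm12` and the barrier no longer depend on
`newman_gaussian_evenMoment_le`.

## The argument (GHS concavity; ours — the source cites [A]/Newman for the domination)

Let `Z(t) = ∑_τ e^{tX(τ)}e^{-βH(τ)}`, `F = log Z`. Then `F′ = ⟨X⟩_t`, `F″ = Var_t(X)` and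
`F‴(t) = ⟨X³⟩_t - 3⟨X²⟩_t⟨X⟩_t + 2⟨X⟩_t³ = ∑_{i,j,k} λᵢλⱼλ_k u₃^{(t)}(i,j,k) ≤ 0` for `t ≥ 0`, the tilted
measure being the spin system with the extra nonnegative fields `tλ` (`ghs_tilt_sum`, from
`ghs_gksSum` summed over the triples with the weights `λᵢλⱼλ_k ≥ 0`; the identification of the tilted
weight is `gksWeight_tilt`). Hence `Var_t(X) ≤ Var_0(X) = ⟨X²⟩₀` on `[0,∞)` (`⟨X⟩₀ = 0` by the spin
flip), `⟨X⟩_t ≤ t⟨X²⟩₀`, and `log Z(t) - log Z(0) ≤ t²⟨X²⟩₀/2` (three applications of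
`antitoneOn_of_deriv_nonpos`); for `t ≤ 0` use `Z(t) = Z(-t)` (spin flip). In infinite volume the
inequality passes to the limit along boxes for `T_{f,L,β} = Σ_L(β)^{-1/2}∑_x f(x/L)σ_x`, `f ≥ 0`
(`tendsto_expectIn_box_fun_smeared` of `…Moments`).

## Contents (namespace `Literature.Barriers.CriticalPhenomena.LongRangeIsing`)

`hasDerivAt_sum_mul_exp_mul`; `gksHamiltonian_tilt`, `gksWeight_tilt`, `gksSum_tilt` (the tilted system as
an instance of the tree's `ν_{Λ;K}`); `sum_pow_three`, `sum_mul_sum_mul_sum`, `sum_finset_sum_mul`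
(bookkeeping); `ghs_tilt_sum` (`Z²M₃ - 3ZM₂M₁ + 2M₁³ ≤ 0`, `t ≥ 0`); `sum_exp_tilt_neg`,
`sum_X_mul_weight_eq_zero` (spin flip); `expectIn_exp_mul_le_of_ghs`; `state_exp_smeared_le_of_ghs`.

## References

* R. Panis, arXiv:2309.05797 (2023) = Ann. Probab. 54 (2026), proof of Theorem 5.5, first two
  displays (p. 21) [Panis2023Triviality] (held; read pp. 21–22).
* J. L. Lebowitz, *GHS and other inequalities*, Comm. Math. Phys. 35 (1974) 87–92, eq. (1.8)
  [Lebowitz1974]; R. B. Griffiths, C. A. Hurst, S. Sherman, J. Math. Phys. 11 (1970) 790–795 (through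
  the tree's `GHSInequality.lean`).
* C. M. Newman, Comm. Math. Phys. 41 (1975) 1–9, Proposition 2 and Theorem 5, eq. (2.8) [Newman1975]
  (held; read pp. 2–3: the route replaced here).
* S. Friedli, Y. Velenik, *Statistical Mechanics of Lattice Systems*, CUP (2017), §3.9, p. 140 (GHS and
  concavity of the magnetisation) [FriedliVelenik2017].
-/

noncomputable section

namespace Literature.Barriers.CriticalPhenomena

open Literature.Probability.LatticeModels Literature.Probability.Percolation Filter Topology Finset Set
open scoped symmDiff

namespace LongRangeIsing

variable {d : ℕ}

/-! ### Tilted sums `t ↦ ∑_τ F(τ) e^{tX(τ)} w(τ)` and their derivatives -/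

section Tilt

variable {Ω : Type*} [Fintype Ω]

/-- `d/dt ∑_τ F(τ) e^{tX(τ)} w(τ) = ∑_τ X(τ)F(τ) e^{tX(τ)} w(τ)`. [folklore] -/
theorem hasDerivAt_sum_mul_exp_mul (F X w : Ω → ℝ) (t : ℝ) :
    HasDerivAt (fun t => ∑ τ, F τ * (Real.exp (t * X τ) * w τ))
      (∑ τ, X τ * F τ * (Real.exp (t * X τ) * w τ)) t := by
  have h : ∀ τ ∈ (Finset.univ : Finset Ω), HasDerivAt (fun t => F τ * (Real.exp (t * X τ) * w τ))
      (X τ * F τ * (Real.exp (t * X τ) * w τ)) t := by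
    intro τ _
    have h1 : HasDerivAt (fun t => t * X τ) (X τ) t := by
      simpa using (hasDerivAt_id t).mul_const (X τ)
    have h2 := ((h1.exp.mul_const (w τ)).const_mul (F τ))
    refine h2.congr_deriv ?_
    ring
  exact HasDerivAt.fun_sum h

end Tilt

/-! ### The GHS inequality for the field-tilted pair interaction: `d/dt Var_t(X) ≤ 0` for `t ≥ 0` -/

section GHS

variable (J : Site d → Site d → ℝ) (Λ : Finset (Site d)) (β : ℝ) (lam : Site d → ℝ)

/-- The couplings of the tilted system: `(β/2)J_{z,w}` on the ordered pairs of `Λ` and the fields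
`tλ_z` on the sites of `Λ`. [folklore] -/
theorem gksHamiltonian_tilt (t : ℝ) (τ : SpinConfig ↥Λ) :
    gksHamiltonian (univ : Finset ((↥Λ × ↥Λ) ⊕ ↥Λ))
        (Sum.elim (fun p : ↥Λ × ↥Λ => β / 2 * J p.1 p.2) (fun z : ↥Λ => t * lam z))
        (Sum.elim (fun p : ↥Λ × ↥Λ => {p.1} ∆ {p.2}) (fun z : ↥Λ => {z})) τ =
      -β * pairHamiltonian J Λ 0 (glue Λ τ .free) + t * ∑ z : ↥Λ, lam z * spinAt z τ := by
  rw [gksHamiltonian, Fintype.sum_sum_type]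
  simp only [Sum.elim_inl, Sum.elim_inr]
  rw [← gksHamiltonian_pair J Λ β τ, gksHamiltonian, Finset.mul_sum]
  congr 1
  refine Finset.sum_congr rfl fun z _ => ?_
  rw [spinProduct, Finset.prod_singleton]
  ring

/-- The tilted weight is `e^{-βH_{Λ,J,0}} e^{tX}` with `X = ∑_{z∈Λ} λ_zσ_z`. [folklore] -/
theorem gksWeight_tilt (t : ℝ) (τ : SpinConfig ↥Λ) :
    gksWeight (univ : Finset ((↥Λ × ↥Λ) ⊕ ↥Λ))
        (Sum.elim (fun p : ↥Λ × ↥Λ => β / 2 * J p.1 p.2) (fun z : ↥Λ => t * lam z))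
        (Sum.elim (fun p : ↥Λ × ↥Λ => {p.1} ∆ {p.2}) (fun z : ↥Λ => {z})) τ =
      Real.exp (t * ∑ z : ↥Λ, lam z * spinAt z τ) * pairGibbsWeight J Λ β 0 τ := by
  rw [gksWeight, gksHamiltonian_tilt, Real.exp_add, pairGibbsWeight, mul_comm]

/-- Tilted unnormalised expectations as plain finite sums. [folklore] -/
theorem gksSum_tilt (t : ℝ) (F : SpinConfig ↥Λ → ℝ) :
    gksSum (univ : Finset ((↥Λ × ↥Λ) ⊕ ↥Λ))
        (Sum.elim (fun p : ↥Λ × ↥Λ => β / 2 * J p.1 p.2) (fun z : ↥Λ => t * lam z))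
        (Sum.elim (fun p : ↥Λ × ↥Λ => {p.1} ∆ {p.2}) (fun z : ↥Λ => {z})) F =
      ∑ τ, F τ * (Real.exp (t * ∑ z : ↥Λ, lam z * spinAt z τ) * pairGibbsWeight J Λ β 0 τ) := by
  rw [gksSum]
  exact Finset.sum_congr rfl fun τ _ => by rw [gksWeight_tilt]

/-- `(∑ᵢ aᵢ)³ = ∑ᵢⱼₖ aᵢ(aⱼa_k)`. [folklore] -/
theorem sum_pow_three {ι : Type*} (s : Finset ι) (a : ι → ℝ) :
    (∑ i ∈ s, a i) ^ 3 = ∑ i ∈ s, ∑ j ∈ s, ∑ k ∈ s, a i * (a j * a k) := by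
  calc (∑ i ∈ s, a i) ^ 3 = (∑ i ∈ s, a i) * ((∑ j ∈ s, a j) * ∑ k ∈ s, a k) := by ring
    _ = (∑ i ∈ s, a i) * ∑ j ∈ s, ∑ k ∈ s, a j * a k := by rw [Finset.sum_mul_sum]
    _ = ∑ i ∈ s, ∑ j ∈ s, a i * ∑ k ∈ s, a j * a k := by rw [Finset.sum_mul_sum]
    _ = ∑ i ∈ s, ∑ j ∈ s, ∑ k ∈ s, a i * (a j * a k) := by simp only [Finset.mul_sum]

/-- `(∑ᵢ aᵢ)(∑ⱼ bⱼ)(∑_k c_k) = ∑ᵢⱼₖ aᵢ(bⱼc_k)`. [folklore] -/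
theorem sum_mul_sum_mul_sum {ι : Type*} (s : Finset ι) (a b c : ι → ℝ) :
    (∑ i ∈ s, a i) * (∑ j ∈ s, b j) * (∑ k ∈ s, c k) = ∑ i ∈ s, ∑ j ∈ s, ∑ k ∈ s, a i * (b j * c k) := by
  calc (∑ i ∈ s, a i) * (∑ j ∈ s, b j) * (∑ k ∈ s, c k)
      = (∑ i ∈ s, a i) * ((∑ j ∈ s, b j) * ∑ k ∈ s, c k) := by ring
    _ = (∑ i ∈ s, a i) * ∑ j ∈ s, ∑ k ∈ s, b j * c k := by rw [Finset.sum_mul_sum]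
    _ = ∑ i ∈ s, ∑ j ∈ s, a i * ∑ k ∈ s, b j * c k := by rw [Finset.sum_mul_sum]
    _ = ∑ i ∈ s, ∑ j ∈ s, ∑ k ∈ s, a i * (b j * c k) := by simp only [Finset.mul_sum]

variable {Ω : Type*} [Fintype Ω]

/-- Linearity of `F ↦ ∑_τ F(τ)W(τ)` over finite sums. [folklore] -/
theorem sum_finset_sum_mul {ι : Type*} (s : Finset ι) (g : ι → Ω → ℝ) (W : Ω → ℝ) :
    ∑ τ, (∑ i ∈ s, g i τ) * W τ = ∑ i ∈ s, ∑ τ, g i τ * W τ := by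
  rw [Finset.sum_comm]
  exact Finset.sum_congr rfl fun τ _ => Finset.sum_mul _ _ _

/-- **The GHS inequality for `X = ∑ λ_zσ_z` under the field-tilted pair interaction** (sum of
`λᵢλⱼλ_k u₃(i,j,k) ≤ 0` over all triples of sites; Griffiths–Hurst–Sherman 1970, Lebowitz 1974,
here through the tree's `ghs_gksSum` for nonnegative couplings on supports of at most two sites):
with `T(F) = ∑_τ F(τ)e^{tX(τ)}e^{-βH(τ)}`, for `β ≥ 0`, `J ≥ 0`, `λ ≥ 0` and `t ≥ 0`,
`T(1)²T(X³) - 3T(1)T(X²)T(X) + 2T(X)³ ≤ 0`, i.e. `d/dt Var_t(X) ≤ 0`.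
[cite: Lebowitz1974, eq. (1.8), eq. (2.3) and Theorem, eq. (2.5b)] -/
theorem ghs_tilt_sum (hβ : 0 ≤ β) (hJ : ∀ x y, 0 ≤ J x y) (hlam : ∀ x, 0 ≤ lam x) {t : ℝ}
    (ht : 0 ≤ t) :
    (∑ τ : SpinConfig ↥Λ, (1 : ℝ) *
        (Real.exp (t * ∑ z : ↥Λ, lam z * spinAt z τ) * pairGibbsWeight J Λ β 0 τ)) ^ 2 *
      (∑ τ : SpinConfig ↥Λ, (∑ z : ↥Λ, lam z * spinAt z τ) ^ 3 *
        (Real.exp (t * ∑ z : ↥Λ, lam z * spinAt z τ) * pairGibbsWeight J Λ β 0 τ)) -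
    3 * (∑ τ : SpinConfig ↥Λ, (1 : ℝ) *
        (Real.exp (t * ∑ z : ↥Λ, lam z * spinAt z τ) * pairGibbsWeight J Λ β 0 τ)) *
      ((∑ τ : SpinConfig ↥Λ, (∑ z : ↥Λ, lam z * spinAt z τ) ^ 2 *
        (Real.exp (t * ∑ z : ↥Λ, lam z * spinAt z τ) * pairGibbsWeight J Λ β 0 τ)) *
      (∑ τ : SpinConfig ↥Λ, (∑ z : ↥Λ, lam z * spinAt z τ) *
        (Real.exp (t * ∑ z : ↥Λ, lam z * spinAt z τ) * pairGibbsWeight J Λ β 0 τ))) +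
    2 * (∑ τ : SpinConfig ↥Λ, (∑ z : ↥Λ, lam z * spinAt z τ) *
        (Real.exp (t * ∑ z : ↥Λ, lam z * spinAt z τ) * pairGibbsWeight J Λ β 0 τ)) ^ 3 ≤ 0 := by
  -- the tilted weight and the functional `T`
  set W : SpinConfig ↥Λ → ℝ := fun τ =>
    Real.exp (t * ∑ z : ↥Λ, lam z * spinAt z τ) * pairGibbsWeight J Λ β 0 τ with hW
  set K : (↥Λ × ↥Λ) ⊕ ↥Λ → ℝ :=
    Sum.elim (fun p : ↥Λ × ↥Λ => β / 2 * J p.1 p.2) (fun z : ↥Λ => t * lam z) with hK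
  set C : (↥Λ × ↥Λ) ⊕ ↥Λ → Finset ↥Λ :=
    Sum.elim (fun p : ↥Λ × ↥Λ => {p.1} ∆ {p.2}) (fun z : ↥Λ => {z}) with hC
  have hS : ∀ F : SpinConfig ↥Λ → ℝ, gksSum univ K C F = ∑ τ, F τ * W τ := fun F =>
    gksSum_tilt J Λ β lam t F
  have hKnn : ∀ i ∈ (univ : Finset ((↥Λ × ↥Λ) ⊕ ↥Λ)), 0 ≤ K i := by
    rintro (p | z) -
    · simp only [hK, Sum.elim_inl]
      exact mul_nonneg (by positivity) (hJ _ _)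
    · simp only [hK, Sum.elim_inr]
      exact mul_nonneg ht (hlam _)
  have hCle : ∀ i ∈ (univ : Finset ((↥Λ × ↥Λ) ⊕ ↥Λ)), (C i).card ≤ 2 := by
    rintro (p | z) -
    · simp only [hC, Sum.elim_inl]
      calc ({p.1} ∆ {p.2} : Finset ↥Λ).card ≤ ({p.1} ∪ {p.2} : Finset ↥Λ).card :=
            Finset.card_le_card (symmDiff_le_sup (a := ({p.1} : Finset ↥Λ)) (b := {p.2}))
        _ ≤ ({p.1} : Finset ↥Λ).card + ({p.2} : Finset ↥Λ).card := Finset.card_union_le _ _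
        _ = 2 := by simp
    · simp [hC]
  -- GHS per triple, in terms of `T`
  set T : (SpinConfig ↥Λ → ℝ) → ℝ := fun F => ∑ τ, F τ * W τ with hT
  have key : ∀ i j k : ↥Λ,
      T (fun _ => 1) ^ 2 * T (fun σ => spinAt i σ * spinAt j σ * spinAt k σ) -
        T (fun _ => 1) * (T (fun σ => spinAt i σ * spinAt j σ) * T (fun σ => spinAt k σ) +
          T (fun σ => spinAt i σ * spinAt k σ) * T (fun σ => spinAt j σ) +
          T (fun σ => spinAt j σ * spinAt k σ) * T (fun σ => spinAt i σ)) +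
        2 * (T (fun σ => spinAt i σ) * T (fun σ => spinAt j σ) * T (fun σ => spinAt k σ)) ≤ 0 := by
    intro i j k
    have h := ghs_gksSum univ K C hKnn hCle i j k
    simp only [hS] at h
    exact h
  -- sum over the triples with the weights `λᵢλⱼλ_k ≥ 0`
  have hsum : ∑ i : ↥Λ, ∑ j : ↥Λ, ∑ k : ↥Λ, lam i * (lam j * lam k) *
      (T (fun _ => 1) ^ 2 * T (fun σ => spinAt i σ * spinAt j σ * spinAt k σ) -
        T (fun _ => 1) * (T (fun σ => spinAt i σ * spinAt j σ) * T (fun σ => spinAt k σ) +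
          T (fun σ => spinAt i σ * spinAt k σ) * T (fun σ => spinAt j σ) +
          T (fun σ => spinAt j σ * spinAt k σ) * T (fun σ => spinAt i σ)) +
        2 * (T (fun σ => spinAt i σ) * T (fun σ => spinAt j σ) * T (fun σ => spinAt k σ))) ≤ 0 :=
    Finset.sum_nonpos fun i _ => Finset.sum_nonpos fun j _ => Finset.sum_nonpos fun k _ =>
      mul_nonpos_of_nonneg_of_nonpos (mul_nonneg (hlam i) (mul_nonneg (hlam j) (hlam k))) (key i j k)
  -- linearity of `T`
  have Tsum : ∀ (g : ↥Λ → SpinConfig ↥Λ → ℝ), T (fun τ => ∑ i, g i τ) = ∑ i, T (g i) := fun g => by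
    simp only [hT]
    exact sum_finset_sum_mul _ g W
  have Tsmul : ∀ (c : ℝ) (g : SpinConfig ↥Λ → ℝ), T (fun τ => c * g τ) = c * T g := fun c g => by
    simp only [hT, Finset.mul_sum]
    exact Finset.sum_congr rfl fun τ _ => by ring
  -- the three expansions
  set X : SpinConfig ↥Λ → ℝ := fun τ => ∑ z : ↥Λ, lam z * spinAt z τ with hX
  have e3 : T (fun τ => X τ ^ 3) = ∑ i : ↥Λ, ∑ j : ↥Λ, ∑ k : ↥Λ,
      lam i * (lam j * lam k) * T (fun σ => spinAt i σ * spinAt j σ * spinAt k σ) := by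
    have hp : (fun τ => X τ ^ 3) = fun τ => ∑ i : ↥Λ, ∑ j : ↥Λ, ∑ k : ↥Λ,
        lam i * (lam j * lam k) * (spinAt i τ * spinAt j τ * spinAt k τ) := by
      funext τ
      rw [hX]
      dsimp only
      rw [sum_pow_three]
      exact Finset.sum_congr rfl fun i _ => Finset.sum_congr rfl fun j _ =>
        Finset.sum_congr rfl fun k _ => by ring
    rw [hp, Tsum]
    refine Finset.sum_congr rfl fun i _ => ?_
    rw [Tsum]
    refine Finset.sum_congr rfl fun j _ => ?_
    rw [Tsum]
    exact Finset.sum_congr rfl fun k _ => Tsmul _ _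
  have e2 : T (fun τ => X τ ^ 2) = ∑ i : ↥Λ, ∑ j : ↥Λ, lam i * lam j * T (fun σ => spinAt i σ * spinAt j σ) := by
    have hp : (fun τ => X τ ^ 2) = fun τ => ∑ i : ↥Λ, ∑ j : ↥Λ,
        lam i * lam j * (spinAt i τ * spinAt j τ) := by
      funext τ
      rw [hX]
      dsimp only
      rw [sq, Finset.sum_mul_sum]
      exact Finset.sum_congr rfl fun i _ => Finset.sum_congr rfl fun j _ => by ring
    rw [hp, Tsum]
    refine Finset.sum_congr rfl fun i _ => ?_
    rw [Tsum]
    exact Finset.sum_congr rfl fun j _ => Tsmul _ _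
  have e1 : T X = ∑ i : ↥Λ, lam i * T (fun σ => spinAt i σ) := by
    rw [hX, Tsum]
    exact Finset.sum_congr rfl fun i _ => Tsmul _ _
  -- assemble: the weighted sum of the GHS combinations is the combination for `X`
  have hcomb : ∑ i : ↥Λ, ∑ j : ↥Λ, ∑ k : ↥Λ, lam i * (lam j * lam k) *
      (T (fun _ => 1) ^ 2 * T (fun σ => spinAt i σ * spinAt j σ * spinAt k σ) -
        T (fun _ => 1) * (T (fun σ => spinAt i σ * spinAt j σ) * T (fun σ => spinAt k σ) +
          T (fun σ => spinAt i σ * spinAt k σ) * T (fun σ => spinAt j σ) +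
          T (fun σ => spinAt j σ * spinAt k σ) * T (fun σ => spinAt i σ)) +
        2 * (T (fun σ => spinAt i σ) * T (fun σ => spinAt j σ) * T (fun σ => spinAt k σ))) =
      T (fun _ => 1) ^ 2 * T (fun τ => X τ ^ 3) - 3 * T (fun _ => 1) * (T (fun τ => X τ ^ 2) * T X) +
        2 * T X ^ 3 := by
    -- the four pieces
    have p1 : ∑ i : ↥Λ, ∑ j : ↥Λ, ∑ k : ↥Λ, lam i * (lam j * lam k) *
        (T (fun _ => 1) ^ 2 * T (fun σ => spinAt i σ * spinAt j σ * spinAt k σ)) =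
        T (fun _ => 1) ^ 2 * T (fun τ => X τ ^ 3) := by
      rw [e3, Finset.mul_sum]
      refine Finset.sum_congr rfl fun i _ => ?_
      rw [Finset.mul_sum]
      refine Finset.sum_congr rfl fun j _ => ?_
      rw [Finset.mul_sum]
      exact Finset.sum_congr rfl fun k _ => by ring
    have p2a : ∑ i : ↥Λ, ∑ j : ↥Λ, ∑ k : ↥Λ, lam i * (lam j * lam k) *
        (T (fun σ => spinAt i σ * spinAt j σ) * T (fun σ => spinAt k σ)) = T (fun τ => X τ ^ 2) * T X := by
      rw [e2, e1, Finset.sum_mul_sum]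
      refine Finset.sum_congr rfl fun i _ => ?_
      rw [Finset.sum_comm]
      refine Finset.sum_congr rfl fun k _ => ?_
      rw [Finset.sum_mul]
      exact Finset.sum_congr rfl fun j _ => by ring
    have p2b : ∑ i : ↥Λ, ∑ j : ↥Λ, ∑ k : ↥Λ, lam i * (lam j * lam k) *
        (T (fun σ => spinAt i σ * spinAt k σ) * T (fun σ => spinAt j σ)) = T (fun τ => X τ ^ 2) * T X := by
      rw [e2, e1, Finset.sum_mul_sum]
      refine Finset.sum_congr rfl fun i _ => ?_
      refine Finset.sum_congr rfl fun j _ => ?_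
      rw [Finset.sum_mul]
      exact Finset.sum_congr rfl fun k _ => by ring
    have p2c : ∑ i : ↥Λ, ∑ j : ↥Λ, ∑ k : ↥Λ, lam i * (lam j * lam k) *
        (T (fun σ => spinAt j σ * spinAt k σ) * T (fun σ => spinAt i σ)) = T X * T (fun τ => X τ ^ 2) := by
      rw [e2, e1, Finset.sum_mul_sum]
      refine Finset.sum_congr rfl fun i _ => ?_
      refine Finset.sum_congr rfl fun j _ => ?_
      symm
      exact (Finset.mul_sum _ _ _).trans (Finset.sum_congr rfl fun k _ => by ring)
    have p3 : ∑ i : ↥Λ, ∑ j : ↥Λ, ∑ k : ↥Λ, lam i * (lam j * lam k) *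
        (T (fun σ => spinAt i σ) * T (fun σ => spinAt j σ) * T (fun σ => spinAt k σ)) = T X ^ 3 := by
      rw [e1, sum_pow_three]
      exact Finset.sum_congr rfl fun i _ => Finset.sum_congr rfl fun j _ =>
        Finset.sum_congr rfl fun k _ => by ring
    -- distribute
    have hd : ∀ i j k : ↥Λ, lam i * (lam j * lam k) *
        (T (fun _ => 1) ^ 2 * T (fun σ => spinAt i σ * spinAt j σ * spinAt k σ) -
          T (fun _ => 1) * (T (fun σ => spinAt i σ * spinAt j σ) * T (fun σ => spinAt k σ) +
            T (fun σ => spinAt i σ * spinAt k σ) * T (fun σ => spinAt j σ) +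
            T (fun σ => spinAt j σ * spinAt k σ) * T (fun σ => spinAt i σ)) +
          2 * (T (fun σ => spinAt i σ) * T (fun σ => spinAt j σ) * T (fun σ => spinAt k σ))) =
        lam i * (lam j * lam k) * (T (fun _ => 1) ^ 2 * T (fun σ => spinAt i σ * spinAt j σ * spinAt k σ)) -
          T (fun _ => 1) * (lam i * (lam j * lam k) *
              (T (fun σ => spinAt i σ * spinAt j σ) * T (fun σ => spinAt k σ)) +
            lam i * (lam j * lam k) * (T (fun σ => spinAt i σ * spinAt k σ) * T (fun σ => spinAt j σ)) +
            lam i * (lam j * lam k) * (T (fun σ => spinAt j σ * spinAt k σ) * T (fun σ => spinAt i σ))) +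
          2 * (lam i * (lam j * lam k) *
            (T (fun σ => spinAt i σ) * T (fun σ => spinAt j σ) * T (fun σ => spinAt k σ))) := by
      intro i j k; ring
    simp only [hd, Finset.sum_add_distrib, Finset.sum_sub_distrib, ← Finset.mul_sum, p1, p2a, p2b, p2c, p3]
    ring
  rw [hcomb] at hsum
  simpa only [hT, hX, one_mul] using hsum

end GHS

/-! ### Gaussian domination of the moment generating function in finite volume -/

section MGF

variable (J : Site d → Site d → ℝ) (Λ : Finset (Site d)) (β : ℝ) (lam : Site d → ℝ)

/-- **Flip symmetry of the tilted partition function**: `Z(t) = Z(-t)` at zero field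
(`τ ↦ -τ` preserves `H_{Λ,J,0}` and reverses `X`). [folklore] -/
theorem sum_exp_tilt_neg (t : ℝ) :
    ∑ τ : SpinConfig ↥Λ, (1 : ℝ) * (Real.exp (-t * ∑ z : ↥Λ, lam z * spinAt z τ) * pairGibbsWeight J Λ β 0 τ) =
      ∑ τ : SpinConfig ↥Λ, (1 : ℝ) * (Real.exp (t * ∑ z : ↥Λ, lam z * spinAt z τ) * pairGibbsWeight J Λ β 0 τ) := by
  rw [← Equiv.sum_comp (Equiv.neg (SpinConfig ↥Λ))]
  refine Finset.sum_congr rfl fun τ _ => ?_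
  have hw : pairGibbsWeight J Λ β 0 (-τ) = pairGibbsWeight J Λ β 0 τ := by
    rw [pairGibbsWeight, pairGibbsWeight, pairHamiltonian_glue_neg]
  have hX : ∑ z : ↥Λ, lam z * spinAt z (-τ) = -∑ z : ↥Λ, lam z * spinAt z τ := by
    rw [← Finset.sum_neg_distrib]
    exact Finset.sum_congr rfl fun z _ => by rw [spinAt_neg]; ring
  simp only [Equiv.neg_apply, hw, hX]
  ring_nf

/-- The odd first moment vanishes at `t = 0`: `∑_τ X(τ) e^{-βH(τ)} = 0` (flip symmetry). [folklore] -/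
theorem sum_X_mul_weight_eq_zero :
    ∑ τ : SpinConfig ↥Λ, (∑ z : ↥Λ, lam z * spinAt z τ) *
      (Real.exp (0 * ∑ z : ↥Λ, lam z * spinAt z τ) * pairGibbsWeight J Λ β 0 τ) = 0 := by
  have hg : Function.Involutive fun τ : SpinConfig ↥Λ => -τ := fun τ => neg_neg τ
  refine sum_eq_zero_of_odd hg _ fun τ => ?_
  have hw : pairGibbsWeight J Λ β 0 (-τ) = pairGibbsWeight J Λ β 0 τ := by
    rw [pairGibbsWeight, pairGibbsWeight, pairHamiltonian_glue_neg]
  have hX : ∑ z : ↥Λ, lam z * spinAt z (-τ) = -∑ z : ↥Λ, lam z * spinAt z τ := by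
    rw [← Finset.sum_neg_distrib]
    exact Finset.sum_congr rfl fun z _ => by rw [spinAt_neg]; ring
  simp only [hw, hX, zero_mul, Real.exp_zero, one_mul]
  ring

/-- **Gaussian domination of the moment generating function of `X = ∑ λ_xσ_x`, `λ ≥ 0`, from the
GHS inequality** (finite volume, free boundary condition, zero field): for a ferromagnetic pair
interaction `J ≥ 0` at `β ≥ 0`,
`⟨e^{tX}⟩_{Λ,J,0,β} ≤ exp((t²/2)⟨X²⟩_{Λ,J,0,β})` for every real `t`.
With `F(t) = log ∑_τ e^{tX}e^{-βH}`: `F′(0) = 0` (flip symmetry), `F″ = Var_t(X)` and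
`F‴ = ∑λᵢλⱼλ_k u₃ ≤ 0` for `t ≥ 0` (GHS: the field `tλ ≥ 0` is a nonnegative one-body coupling),
so `F″ ≤ F″(0) = ⟨X²⟩` on `[0,∞)` and `F(t) - F(0) ≤ t²⟨X²⟩/2`; `t ≤ 0` by `Z(t) = Z(-t)`. This
is the moment-generating-function form of the Gaussian domination of the even moments used in
Panis 2023, proof of Theorem 5.5 (summation step) — there via Newman's inequality; the concavity
route is Griffiths–Hurst–Sherman's ("concavity of the magnetization in a positive external field").
[cite: Lebowitz1974, eq. (1.8), eq. (2.3) and Theorem, eq. (2.5b)] [cite: FriedliVelenik2017, §3.9, p. 140 (GHS inequality)] -/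
theorem expectIn_exp_mul_le_of_ghs (hβ : 0 ≤ β) (hJ : ∀ x y, 0 ≤ J x y) (hlam : ∀ x, 0 ≤ lam x)
    (t : ℝ) :
    expectIn J Λ β 0 (fun σ => Real.exp (t * ∑ x ∈ Λ, lam x * spinAt x σ)) ≤
      Real.exp (t ^ 2 / 2 * expectIn J Λ β 0 (fun σ => (∑ x ∈ Λ, lam x * spinAt x σ) ^ 2)) := by
  -- the observables on `Λ`-configurations
  set X : SpinConfig ↥Λ → ℝ := fun τ => ∑ z : ↥Λ, lam z * spinAt z τ with hX
  set w : SpinConfig ↥Λ → ℝ := fun τ => pairGibbsWeight J Λ β 0 τ with hw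
  have hglueX : ∀ τ : SpinConfig ↥Λ, ∑ x ∈ Λ, lam x * spinAt x (glue Λ τ .free) = X τ := by
    intro τ
    rw [hX, ← Finset.sum_coe_sort Λ]
    exact Finset.sum_congr rfl fun z _ => by rw [spinAt_glue_coe]
  -- the tilted sums
  set Z : ℝ → ℝ := fun s => ∑ τ, (1 : ℝ) * (Real.exp (s * X τ) * w τ) with hZ
  set M1 : ℝ → ℝ := fun s => ∑ τ, X τ * (Real.exp (s * X τ) * w τ) with hM1
  set M2 : ℝ → ℝ := fun s => ∑ τ, X τ ^ 2 * (Real.exp (s * X τ) * w τ) with hM2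
  set M3 : ℝ → ℝ := fun s => ∑ τ, X τ ^ 3 * (Real.exp (s * X τ) * w τ) with hM3
  have hZpos : ∀ s, 0 < Z s := fun s => by
    simp only [hZ, one_mul]
    exact Finset.sum_pos (fun τ _ => mul_pos (Real.exp_pos _) (pairGibbsWeight_pos J Λ β 0 τ))
      Finset.univ_nonempty
  -- derivatives
  have dZ : ∀ s, HasDerivAt Z (M1 s) s := fun s => by
    have h := hasDerivAt_sum_mul_exp_mul (fun _ => (1 : ℝ)) X w s
    simp only [mul_one] at h
    exact h
  have dM1 : ∀ s, HasDerivAt M1 (M2 s) s := fun s => by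
    have h := hasDerivAt_sum_mul_exp_mul X X w s
    exact h.congr_deriv (Finset.sum_congr rfl fun τ _ => by ring)
  have dM2 : ∀ s, HasDerivAt M2 (M3 s) s := fun s => by
    have h := hasDerivAt_sum_mul_exp_mul (fun τ => X τ ^ 2) X w s
    exact h.congr_deriv (Finset.sum_congr rfl fun τ _ => by ring)
  -- GHS: `Z²M3 - 3 Z M2 M1 + 2 M1³ ≤ 0` for `s ≥ 0`
  have hGHS : ∀ s, 0 ≤ s → Z s ^ 2 * M3 s - 3 * Z s * (M2 s * M1 s) + 2 * M1 s ^ 3 ≤ 0 := fun s hs =>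
    ghs_tilt_sum J Λ β lam hβ hJ hlam hs
  -- the variance `V = M2/Z - (M1/Z)²` is nonincreasing on `[0, ∞)`
  set V : ℝ → ℝ := fun s => M2 s / Z s - (M1 s / Z s) ^ 2 with hV
  have dV : ∀ s, HasDerivAt V ((Z s ^ 2 * M3 s - 3 * Z s * (M2 s * M1 s) + 2 * M1 s ^ 3) / Z s ^ 3) s := by
    intro s
    have hZne : Z s ≠ 0 := (hZpos s).ne'
    have h1 := (dM2 s).div (dZ s) hZne
    have h2 := (dM1 s).div (dZ s) hZne
    have h3 : HasDerivAt (fun x => M2 x / Z x - M1 x / Z x * (M1 x / Z x))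
        ((M3 s * Z s - M2 s * M1 s) / Z s ^ 2 -
          ((M2 s * Z s - M1 s * M1 s) / Z s ^ 2 * (M1 s / Z s) +
            M1 s / Z s * ((M2 s * Z s - M1 s * M1 s) / Z s ^ 2))) s := h1.sub (h2.mul h2)
    have hVfun : V = fun x => M2 x / Z x - M1 x / Z x * (M1 x / Z x) := by
      funext x
      simp only [hV]
      ring
    rw [hVfun]
    refine h3.congr_deriv ?_
    field_simp
    ring
  have hVanti : AntitoneOn V (Ici 0) := by
    refine antitoneOn_of_deriv_nonpos (convex_Ici 0) (fun s _ => (dV s).continuousAt.continuousWithinAt)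
      (fun s _ => (dV s).differentiableAt.differentiableWithinAt) ?_
    intro s hs
    rw [interior_Ici] at hs
    rw [(dV s).deriv]
    exact div_nonpos_of_nonpos_of_nonneg (hGHS s (le_of_lt hs)) (pow_nonneg (hZpos s).le 3)
  -- `M1/Z - s V(0)` is nonincreasing on `[0, ∞)`, hence `≤ 0` (it vanishes at `0`)
  have hM10 : M1 0 = 0 := by
    simp only [hM1]
    exact sum_X_mul_weight_eq_zero J Λ β lam
  set g : ℝ → ℝ := fun s => M1 s / Z s - s * V 0 with hg
  have dg : ∀ s, HasDerivAt g (V s - V 0) s := by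
    intro s
    have hZne : Z s ≠ 0 := (hZpos s).ne'
    have h1 := (dM1 s).div (dZ s) hZne
    have h2 : HasDerivAt (fun s : ℝ => s * V 0) (V 0) s := by simpa using (hasDerivAt_id s).mul_const (V 0)
    refine (h1.sub h2).congr_deriv ?_
    simp only [hV]
    field_simp
  have hganti : AntitoneOn g (Ici 0) := by
    refine antitoneOn_of_deriv_nonpos (convex_Ici 0) (fun s _ => (dg s).continuousAt.continuousWithinAt)
      (fun s _ => (dg s).differentiableAt.differentiableWithinAt) ?_
    intro s hs
    rw [interior_Ici] at hs
    rw [(dg s).deriv, sub_nonpos]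
    exact hVanti (mem_Ici.2 le_rfl) (mem_Ici.2 (le_of_lt hs)) (le_of_lt hs)
  have hg0 : g 0 = 0 := by simp [hg, hM10]
  have hgle : ∀ s, 0 ≤ s → g s ≤ 0 := fun s hs => by
    have h := hganti (mem_Ici.2 le_rfl) (mem_Ici.2 hs) hs
    rwa [hg0] at h
  -- `log Z(s) - s² V(0)/2` is nonincreasing on `[0, ∞)`
  set φ : ℝ → ℝ := fun s => Real.log (Z s) - V 0 / 2 * s ^ 2 with hφ
  have dφ : ∀ s, HasDerivAt φ (g s) s := by
    intro s
    have h1 := (dZ s).log (hZpos s).ne'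
    have h2 : HasDerivAt (fun x : ℝ => V 0 / 2 * x ^ 2) (V 0 / 2 * ((2 : ℕ) * s ^ (2 - 1))) s :=
      (hasDerivAt_pow 2 s).const_mul (V 0 / 2)
    refine (h1.sub h2).congr_deriv ?_
    rw [hg, Nat.cast_ofNat, show (2 : ℕ) - 1 = 1 from rfl, pow_one]
    ring
  have hφanti : AntitoneOn φ (Ici 0) := by
    refine antitoneOn_of_deriv_nonpos (convex_Ici 0) (fun s _ => (dφ s).continuousAt.continuousWithinAt)
      (fun s _ => (dφ s).differentiableAt.differentiableWithinAt) ?_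
    intro s hs
    rw [interior_Ici] at hs
    rw [(dφ s).deriv]
    exact hgle s (le_of_lt hs)
  -- conclusion for `s ≥ 0`: `Z(s) ≤ Z(0) exp(s² V(0)/2)`
  have hpos : ∀ s, 0 ≤ s → Z s ≤ Z 0 * Real.exp (s ^ 2 / 2 * V 0) := by
    intro s hs
    have h := hφanti (mem_Ici.2 le_rfl) (mem_Ici.2 hs) hs
    simp only [hφ] at h
    have h' : Real.log (Z s) ≤ Real.log (Z 0) + s ^ 2 / 2 * V 0 := by
      have : V 0 / 2 * (0 : ℝ) ^ 2 = 0 := by ring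
      rw [this, sub_zero] at h
      linarith
    calc Z s = Real.exp (Real.log (Z s)) := (Real.exp_log (hZpos s)).symm
      _ ≤ Real.exp (Real.log (Z 0) + s ^ 2 / 2 * V 0) := Real.exp_le_exp.2 h'
      _ = Z 0 * Real.exp (s ^ 2 / 2 * V 0) := by rw [Real.exp_add, Real.exp_log (hZpos 0)]
  -- all `t` by the flip symmetry `Z(t) = Z(-t)`
  have hall : Z t ≤ Z 0 * Real.exp (t ^ 2 / 2 * V 0) := by
    rcases le_total 0 t with ht | ht
    · exact hpos t ht
    · have h := hpos (-t) (by linarith)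
      have hZt : Z t = Z (-t) := by
        simp only [hZ]
        have := sum_exp_tilt_neg J Λ β lam t
        rw [← this]
      rw [hZt]
      simpa [neg_sq] using h
  -- identification with `expectIn`
  have hV0 : V 0 = expectIn J Λ β 0 (fun σ => (∑ x ∈ Λ, lam x * spinAt x σ) ^ 2) := by
    simp only [hV, hM10, zero_div, zero_pow two_ne_zero, sub_zero]
    rw [expectIn]
    simp only [hM2, hZ, hw, hglueX, zero_mul, Real.exp_zero, one_mul]
  have hE : expectIn J Λ β 0 (fun σ => Real.exp (t * ∑ x ∈ Λ, lam x * spinAt x σ)) = Z t / Z 0 := by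
    rw [expectIn]
    simp only [hZ, hw, hglueX, zero_mul, Real.exp_zero, one_mul]
  rw [hE, ← hV0, div_le_iff₀ (hZpos 0)]
  linarith [hall, mul_comm (Z 0) (Real.exp (t ^ 2 / 2 * V 0))]

end MGF

/-! ### In the infinite-volume state: the smeared observables `T_{f,L,β}` with `f ≥ 0` -/

section State

variable (J : Site d → Site d → ℝ) {β : ℝ}

/-- **Gaussian domination of `⟨exp(t T_{f,L,β})⟩_{J,0,β}` for `f ≥ 0`**: for `β ≥ 0`, `J ≥ 0` and
`f ≥ 0` vanishing (at scale `L`) off a finite window,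
`⟨exp(t T_{f,L,β})⟩_{J,0,β} ≤ exp((t²/2)⟨T_{f,L,β}²⟩_{J,0,β})` for every real `t` (the finite-volume
GHS bound `expectIn_exp_mul_le_of_ghs` for `X = ∑_x f(x/L)Σ_L(β)^{-1/2}σ_x` in every box containing
the window, passed to the limit along boxes). It replaces, in the summation step of the proof of
Panis 2023, Theorem 5.5, the term-by-term Gaussian domination of the even moments of `T_{|f|,L,β}`.
[cite: Panis2023Triviality, proof of Theorem 5.5, first two displays (p. 21)] -/
theorem state_exp_smeared_le_of_ghs (hJ : ∀ x y, 0 ≤ J x y) (hβ : 0 ≤ β) (L : ℕ)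
    (f : EuclideanSpace ℝ (Fin d) → ℝ) (hf0 : ∀ x, 0 ≤ f x) {B : Finset (Site d)}
    (hsupp : ∀ x : Site d, f ((L : ℝ)⁻¹ • siteVec x) ≠ 0 → x ∈ B) (t : ℝ) :
    state J β 0 (fun σ => Real.exp (t * smeared J β L f σ)) ≤
      Real.exp (t ^ 2 / 2 * state J β 0 (fun σ => smeared J β L f σ ^ 2)) := by
  obtain ⟨L₀, hL₀⟩ := exists_forall_subset_box d B
  set lam : Site d → ℝ := fun x => f ((L : ℝ)⁻¹ • siteVec x) / Real.sqrt (blockVariance J β L) with hlam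
  have hlam0 : ∀ x, 0 ≤ lam x := fun x => div_nonneg (hf0 _) (Real.sqrt_nonneg _)
  -- in a box containing `B`, `T_{f,L,β} = ∑_{x ∈ Λ} λ_x σ_x`
  have hT : ∀ L' : ℕ, L₀ ≤ L' → ∀ σ : SpinConfig (Site d),
      smeared J β L f σ = ∑ x ∈ box d L', lam x * spinAt x σ := by
    intro L' hL' σ
    have hsuppL : ∀ x : Site d, f ((L : ℝ)⁻¹ • siteVec x) ≠ 0 → x ∈ box d L' := fun x hx => hL₀ L' hL' (hsupp x hx)
    have hsub : Function.support (fun x : Site d => f ((L : ℝ)⁻¹ • siteVec x) * spinAt x σ) ⊆ ↑(box d L') := by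
      intro x hx
      rw [Function.mem_support] at hx
      exact Finset.mem_coe.2 (hsuppL x fun h0 => hx (by rw [h0, zero_mul]))
    rw [smeared, finsum_eq_sum_of_support_subset _ hsub, Finset.sum_div]
    refine Finset.sum_congr rfl fun x _ => ?_
    rw [hlam]
    ring
  have hev : ∀ᶠ L' : ℕ in atTop, expectIn J (box d L') β 0 (fun σ => Real.exp (t * smeared J β L f σ)) ≤
      Real.exp (t ^ 2 / 2 * expectIn J (box d L') β 0 (fun σ => smeared J β L f σ ^ 2)) := by
    filter_upwards [eventually_ge_atTop L₀] with L' hL'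
    have h := expectIn_exp_mul_le_of_ghs J (box d L') β lam hβ hJ hlam0 t
    have e1 : (fun σ => Real.exp (t * smeared J β L f σ)) =
        fun σ => Real.exp (t * ∑ x ∈ box d L', lam x * spinAt x σ) :=
      funext fun σ => by rw [hT L' hL' σ]
    have e2 : (fun σ => smeared J β L f σ ^ 2) = fun σ => (∑ x ∈ box d L', lam x * spinAt x σ) ^ 2 :=
      funext fun σ => by rw [hT L' hL' σ]
    rw [e1, e2]
    exact h
  have h1 := tendsto_expectIn_box_fun_smeared J β hβ hJ L f hsupp fun u => Real.exp (t * u)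
  have h2 := tendsto_expectIn_box_fun_smeared J β hβ hJ L f hsupp fun u => u ^ 2
  have h3 : Tendsto (fun L' : ℕ => Real.exp (t ^ 2 / 2 * expectIn J (box d L') β 0 (fun σ => smeared J β L f σ ^ 2)))
      atTop (𝓝 (Real.exp (t ^ 2 / 2 * state J β 0 (fun σ => smeared J β L f σ ^ 2)))) :=
    ((Real.continuous_exp.tendsto _).comp (h2.const_mul (t ^ 2 / 2)))
  exact le_of_tendsto_of_tendsto h1 h3 hev

end State

end LongRangeIsing

end Literature.Barriers.CriticalPhenomena

end
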